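import Literature.NumberTheory.EllipticCurves.Kato2004.HullDescentEqualityProofs
import HarnessLib

/-!
# Kato's §14.14–14.15 descent through the reflexive hull — the `μ`-DEFECT form (divisibility known only
# OFF the prime `(p)`): `e + ord_p #(H2/TH2) ≤ ord_p [A : Λ·ι(ȳ)] + μ(H2)`
# (module theory over `Λ = ℤ_p⟦T⟧`; companion of `HullDescentSkeletonProofs` / `HullDescentEqualityProofs`;
# theorems only)

Kato's Thm. 12.5 (3) gives the divisibility `ℓ_𝔮(𝐇²(T)⁰) ≤ ℓ_𝔮(𝐇¹(T)⁰/z)` at the height-one primes `𝔮`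
NOT containing `p` with no hypothesis on the image of the Galois representation (the exception (12.5.1)
does not occur at a potentially good `p`, Remark 12.7); the prime `𝔮 = (p)` is where Thm. 12.5 (4) needs
(12.5.2) (or, on reducible rows, Wuthrich's Lemma 14). This file records what the hull descent gives when
the divisibility is known only off `(p)`: the `Γ`-Euler exponents satisfy `e(H2) ≤ e(F/Λz) + μ(H2)`
(`eulerExp_le_add_muInvariant_of_lengthAt_le_off_p`: the weight of `(p)` in `e(·)` is
`v_p(q_{(p)}(0)) = 1`), hence Kato's exponent `m = e(F/Λz) − e(H2)` (exact index,
`padicValNat_index_eq_of_hull`) is `≥ −μ(H2)`: **`e + ord_p #(H2/TH2) ≤ ord_p [A : Λ·ι(ȳ)] + μ(H2)`** —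
the upper half of the count fails by AT MOST the `μ`-invariant of `𝐇²(T)⁰` (Coates–Sujatha's
Conjecture A predicts `μ(𝐇²(T)) = 0`). Module theory only; nothing about Kato's objects is asserted.
Consumer: `Summits/BirchSwinnertonDyer/Rank1Residual/O6/X3KatoMemberBoundMuDefect.lean`.

References: [Kato2004Asterisque] Thm. 12.5 (3)–(4) and Remark 12.7 (p. 222), §14.14 and Lemma 14.15
(pp. 243–244), Prop. 14.16 (2) (p. 244); [Wuthrich2014] Lemma 14 (p. 396); [CoatesSujatha2005] Conj. A;
the `Γ`-Euler characteristic: [Washington1997] §13.2, [GreenbergLNM1716] §4 Lemma 4.2.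
-/

noncomputable section

open scoped Classical

universe u

namespace Literature.NumberTheory.EllipticCurves.Kato2004

open Literature.NumberTheory.EllipticCurves.IwasawaAlgebra

variable {p : ℕ} [Fact p.Prime]

/-! ### §1 Euler exponents when the divisibility is known only off `(p)` -/

section OffP

variable {M N : Type u} [AddCommGroup M] [Module (IwasawaAlgebra p) M]
  [AddCommGroup N] [Module (IwasawaAlgebra p) N]
  [Module.Finite (IwasawaAlgebra p) M] [Module.Finite (IwasawaAlgebra p) N]

/-- **`e(M) ≤ e(N) + μ(M)` when `ℓ_𝔮(M) ≤ ℓ_𝔮(N)` at every height-one prime `𝔮 ≠ (p)`** (both finitely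
generated torsion): the `Γ`-Euler exponent `e(·) = Σ_{𝔮 ≠ (T)} ℓ_𝔮(·)·v_p(q_𝔮(0))` weighs the prime `(p)`
with `v_p(q_{(p)}(0)) = 1`, so the only uncontrolled term is `ℓ_{(p)}(M) = μ(M)`.
[cite: Kato2004Asterisque, Thm. 12.5 (3) (p. 222), Lemma 14.15 (p. 244)] [cite: Washington1997, §13.2] -/
theorem eulerExp_le_add_muInvariant_of_lengthAt_le_off_p (hM : Module.IsTorsion (IwasawaAlgebra p) M)
    (hN : Module.IsTorsion (IwasawaAlgebra p) N)
    (h : ∀ 𝔮 : PrimeSpectrum (IwasawaAlgebra p), 𝔮.asIdeal.height = 1 → 𝔮.asIdeal ≠ augIdealP p →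
      Module.lengthAt (IwasawaAlgebra p) M 𝔮 ≤ Module.lengthAt (IwasawaAlgebra p) N 𝔮) :
    eulerExp p M ≤ eulerExp p N + muInvariant p M := by
  let 𝔭 : PrimeSpectrum (IwasawaAlgebra p) := ⟨augIdealP p, isPrime_augIdealP_holds p⟩
  have h𝔭 : 𝔭 ∈ heightOneNeT p := mem_heightOneNeT_of_asIdeal_eq_augIdealP 𝔭 rfl
  -- a common finite index set containing `(p)`
  have hSM := finite_heightOneNeT_inter_support M hM
  have hSN := finite_heightOneNeT_inter_support N hN
  set S : Finset (PrimeSpectrum (IwasawaAlgebra p)) := (hSM.union hSN).toFinset ∪ {𝔭} with hS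
  have hsubM : heightOneNeT p ∩ Function.support (fun 𝔮 ↦
      (Module.lengthAt (IwasawaAlgebra p) M 𝔮).toNat * constVal p 𝔮) ⊆ S := by
    intro x hx
    rw [hS, Finset.coe_union, Set.Finite.coe_toFinset]
    exact Or.inl (Or.inl hx)
  have hsubN : heightOneNeT p ∩ Function.support (fun 𝔮 ↦
      (Module.lengthAt (IwasawaAlgebra p) N 𝔮).toNat * constVal p 𝔮) ⊆ S := by
    intro x hx
    rw [hS, Finset.coe_union, Set.Finite.coe_toFinset]
    exact Or.inl (Or.inr hx)
  have hSsub : (S : Set (PrimeSpectrum (IwasawaAlgebra p))) ⊆ heightOneNeT p := by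
    intro x hx
    rw [hS, Finset.coe_union, Set.Finite.coe_toFinset, Finset.coe_singleton] at hx
    rcases hx with (hx | hx) | hx
    · exact hx.1
    · exact hx.1
    · rw [Set.mem_singleton_iff] at hx; rw [hx]; exact h𝔭
  have h𝔭S : 𝔭 ∈ S := by rw [hS]; exact Finset.mem_union_right _ (Finset.mem_singleton_self _)
  have eM : eulerExp p M = ∑ 𝔮 ∈ S, (Module.lengthAt (IwasawaAlgebra p) M 𝔮).toNat * constVal p 𝔮 :=
    finsum_mem_eq_sum_of_subset _ hsubM hSsub
  have eN : eulerExp p N = ∑ 𝔮 ∈ S, (Module.lengthAt (IwasawaAlgebra p) N 𝔮).toNat * constVal p 𝔮 :=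
    finsum_mem_eq_sum_of_subset _ hsubN hSsub
  -- the `(p)`-term of `e(M)` is `μ(M)`
  have hμ : muInvariant p M = (Module.lengthAt (IwasawaAlgebra p) M 𝔭).toNat * constVal p 𝔭 := by
    rw [muInvariant_eq_toNat_lengthAt p M 𝔭 rfl, constVal_eq_one_of_asIdeal_eq_augIdealP 𝔭 rfl, mul_one]
  -- pointwise bound with a correction supported at `(p)`
  have hle : ∀ i ∈ S, (Module.lengthAt (IwasawaAlgebra p) M i).toNat * constVal p i ≤
      (Module.lengthAt (IwasawaAlgebra p) N i).toNat * constVal p i +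
        (if i = 𝔭 then (Module.lengthAt (IwasawaAlgebra p) M i).toNat * constVal p i else 0) := by
    intro i hi
    by_cases hi𝔭 : i = 𝔭
    · rw [if_pos hi𝔭]; exact Nat.le_add_left _ _
    · rw [if_neg hi𝔭, add_zero]
      have hi' := hSsub (Finset.mem_coe.mpr hi)
      have hne : i.asIdeal ≠ augIdealP p := by
        intro heq
        exact hi𝔭 (PrimeSpectrum.ext heq)
      exact Nat.mul_le_mul_right _ (ENat.toNat_le_toNat (h i hi'.1 hne)
        (IwasawaAlgebra.lengthAt_ne_top_of_isTorsion N hN i (le_of_eq hi'.1)))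
  have hsum := Finset.sum_le_sum hle
  rw [Finset.sum_add_distrib, Finset.sum_ite_eq' S 𝔭, if_pos h𝔭S] at hsum
  rw [eM, eN, hμ]
  exact hsum

end OffP

/-! ### §2 The hull descent with the `μ`-defect -/

section Hull

variable {F H H2 A : Type u} [AddCommGroup F] [Module (IwasawaAlgebra p) F]
  [AddCommGroup H] [Module (IwasawaAlgebra p) H] [AddCommGroup H2] [Module (IwasawaAlgebra p) H2]
  [AddCommGroup A] [Module (IwasawaAlgebra p) A]
  [Module.Finite (IwasawaAlgebra p) F] [NoZeroSMulDivisors (IwasawaAlgebra p) F]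
  [Module.Finite (IwasawaAlgebra p) H] [NoZeroSMulDivisors (IwasawaAlgebra p) H]
  [Module.Finite (IwasawaAlgebra p) H2]

/-- **THE HULL DESCENT WITH THE `μ`-DEFECT: `e + ord_p #(H2/TH2) ≤ ord_p [A : Λ·ι(ȳ)] + μ(H2)`** when the
divisibility `ℓ_𝔮(H2) ≤ ℓ_𝔮(F/Λz)` is known only at the height-one primes `𝔮 ≠ (p)` (Kato's Thm. 12.5 (3),
image-free) — i.e. Kato's `μ = [A : z]/#H²(ℤ[1/p],T) = p^m` has `m ≥ −μ(𝐇²(T)⁰)`: the count's upper half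
can fail by at most the `μ`-invariant of `𝐇²(T)⁰`, which Coates–Sujatha's Conjecture A predicts to vanish.
Data as in `index_eq_natCard_invariants_mul_pow_of_hull`. Module theory only.
[cite: Kato2004Asterisque, Thm. 12.5 (3) and Remark 12.7 (p. 222), §14.14 and Lemma 14.15 (pp. 243–244), Prop. 14.16 (2) (p. 244)]
[cite: CoatesSujatha2005, Conjecture A] -/
theorem padicValNat_natCard_coinvariants_add_le_index_add_muInvariant_of_hull
    (j : H →ₗ[IwasawaAlgebra p] F)
    (hj : Function.Injective j) (hcok : Finite (F ⧸ LinearMap.range j)) (z : F) (hz : z ≠ 0)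
    (hFZ : Module.IsTorsion (IwasawaAlgebra p) (F ⧸ (IwasawaAlgebra p) ∙ z))
    (hH2 : Module.IsTorsion (IwasawaAlgebra p) H2)
    (hdivOff : ∀ 𝔮 : PrimeSpectrum (IwasawaAlgebra p), 𝔮.asIdeal.height = 1 →
      𝔮.asIdeal ≠ augIdealP p →
      Module.lengthAt (IwasawaAlgebra p) H2 𝔮 ≤
        Module.lengthAt (IwasawaAlgebra p) (F ⧸ (IwasawaAlgebra p) ∙ z) 𝔮)
    (y : H) (e : ℕ) (hy : j y = PowerSeries.C ((p : ℤ_[p]) ^ e) • z)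
    (ι : coinvariants p H →ₗ[IwasawaAlgebra p] A) (π : A →ₗ[IwasawaAlgebra p] invariants p H2)
    (hι : Function.Injective ι) (hπ : Function.Surjective π) (hex : Function.Exact ι π)
    (hfin : Finite (coinvariants p H2))
    (hne : Nat.card (A ⧸ (IwasawaAlgebra p) ∙ ι (Submodule.Quotient.mk y)) ≠ 0) :
    e + padicValNat p (Nat.card (coinvariants p H2)) ≤
      padicValNat p (Nat.card (A ⧸ (IwasawaAlgebra p) ∙ ι (Submodule.Quotient.mk y))) +
        muInvariant p H2 := by
  have hidx := padicValNat_index_eq_of_hull j hj hcok z hz hFZ hH2 y e hy ι π hι hπ hex hfin hne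
  have hle := eulerExp_le_add_muInvariant_of_lengthAt_le_off_p hH2 hFZ hdivOff
  have hle' : (eulerExp p H2 : ℤ) ≤ (eulerExp p (F ⧸ (IwasawaAlgebra p) ∙ z) : ℤ) + muInvariant p H2 := by
    exact_mod_cast hle
  have key : (e : ℤ) + (padicValNat p (Nat.card (coinvariants p H2)) : ℤ) ≤
      (padicValNat p (Nat.card (A ⧸ (IwasawaAlgebra p) ∙ ι (Submodule.Quotient.mk y))) : ℤ) +
        muInvariant p H2 := by
    linarith
  exact_mod_cast key

end Hull

end Literature.NumberTheory.EllipticCurves.Kato2004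

end
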